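import Summits.CriticalPhenomena.CardyFormulaZ2.Theorems.CardyBoundaryCoulombGasBoundaryDefectGaussianRStubRealisabilityPart37

/-!
# Stub `stub_dictionaryPositivity` of line `rainbow-monomials-in-excursion-kernels` — Part 38:
# tracked cuts are strand ends (IV): the theorem — hypothesis (E1) of the rainbow forcing
# (crux `BoundaryDefectGaussianR`, stmt-CriticalPhenomena-14132; insertion dictionary D2, layer 3b)

Last of four files (Parts 35–38). THEOREM (`tc_trackedCuts_are_ends`, registered one-line form
`s14_trackedCuts_are_ends`): for an ADMISSIBLE leg insertion `ι` on `V` with FLAT insertion points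
(radius `sinkLegs + 3`) and local CHARTS at the boundary vertices of `V` (hypotheses `FLAT`, `CHART`
of Part 34), every TRACKED corner `c` of the jump collar `ι.model V` that is a CUT
(`CollarLegModel.IsCut`: frozen target, inconsistent turn of the prescribed data) is a registered
strand end: `∃ m, (c, m) ∈ ι.strandEnds V` — hypothesis (E1) of `s14_rainbow_of_valid` (Part 18)
and of `rainbow_of_strandEnds_of_admissible` (Part 19).

Proof. Let `c = (x, k)` with target edge `e = {x, x + dir (k+1)}` (frozen, since `c` is a cut).
* `e` OPEN: the turn is consistent (`tc_turnConsistent_of_open`, Part 37) — not a cut.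
* `e` CLOSED, `x ∈ V`: then `x + dir (k+1) ∉ V` and `c` is the finish `(x, K + 3)`, `K = k + 1`, of a
  jump dart `(x, K)` of the walk (`tc_vertex_closed_end`, Part 37).
* `e` CLOSED, `x = g` a ghost: the face of `c` is the gap face of an exterior dart touching `g`
  (Part 35), which lies on the cycle, `= ds[s]`, by the chain lemma at `g` and the dart of the entry
  MENTIONING `g` (`tc_ghost_mention`, Part 36). If `ds[s]` is active, or free on both sides
  (`tc_free_touch`, Part 37), some ACTIVE dart `ds[tₐ] = (c₀, K)` touches `g` (`tc_active_touch`):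
  it is a rail dart with a frame chart of half-width `3` (`tc_active_rail3`), `g` is the rail ghost
  `c₀ + dir K` of `ds[tₐ]` or of the next rail dart, and `tc_railGhost_end` (Part 36) applies — `c` is
  the end of a junction opening the arc. If `ds[s]` is silent and wired, its gap face is a POCKET and
  `e`, an edge of it, is a pocket edge or a spoke (`pocketCorner_mem_arc`, Part 13): open,
  contradiction (`tc_ghost_closed_end`).

Corollary `tc_rainbow_of_consistent`: the rainbow forcing of Part 19 with ALL strand-end inputs
discharged — for such `(ι, V)`, `ω ⊆ E` and a valid `h` all of whose live turns are consistent in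
`cfgOf ω`, `ι.Rainbow V ω` ("`A(ω) ≠ 0 ⇒ Rainbow ω`").

Unit evidence: `#eval` over the 18 admissible placements of worker `rainbowOfValid` (`TestEnds.lean`
in the session): no tracked cut outside `strandEnds`.
-/

namespace Summit.CriticalPhenomena.CardyFormulaZ2.Cruxes.BoundaryDefectGaussianR.RainbowMonomialsInExcursionKernels

open Literature.Probability.LatticeModels Literature.Probability.LatticeModels.CollarLegModel

/-- A point and its unit translate are lattice-adjacent (the adjacency clause of
`pocketCorner_mem_arc`, with `p = g + dir j`, `q = g`). [folklore] -/
theorem tc_adj_add_dir (g : ℤ × ℤ) (j : Fin 4) :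
    (g.1 = (g + dir j).1 + 1 ∧ g.2 = (g + dir j).2) ∨ (g.1 = (g + dir j).1 ∧ g.2 = (g + dir j).2 + 1) ∨
      ((g + dir j).1 = g.1 + 1 ∧ (g + dir j).2 = g.2) ∨ ((g + dir j).1 = g.1 ∧ (g + dir j).2 = g.2 + 1) := by
  obtain ⟨a, b⟩ := g
  fin_cases j <;> simp [dir]

section Admissible

variable (ι : LegInsertionData) (V : Finset (ℤ × ℤ)) {d₀ : Dart} (hadm : ι.IsAdmissible V)
  (h : outDart V ι.sink = some d₀) {st : ℕ → WalkState}
  (hst : ∀ t, st t = List.foldl (fun s d => s.step (ι.startAt V d)) ι.init ((cycle V d₀).take t))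

include hadm h hst in
/-- **A tracked closed corner at a ghost touched by an ACTIVE dart is a registered end.** If the
level changes at dart `tₐ` and the ghost `g ∉ V` is a corner of its gap face, then `ds[tₐ] = (c₀, K)`
is a rail dart with a frame chart of half-width `3`, `g` is `c₀ + dir K` or `c₀ + dir (K+1) + dir K`
(the ghost of `ds[tₐ]` or of the next rail dart), and `tc_railGhost_end` applies there. [folklore] -/
theorem tc_active_touch
    (hflat : ∀ x ∈ insert ι.sink ι.source, ∃ dvec : ℤ × ℤ,
      (dvec = (1, 0) ∨ dvec = (-1, 0) ∨ dvec = (0, 1) ∨ dvec = (0, -1)) ∧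
      ∀ v : ℤ × ℤ, (v.1 - x.1) ^ 2 + (v.2 - x.2) ^ 2 ≤ ((ι.sinkLegs : ℤ) + 3) ^ 2 →
        (v ∈ V ↔ 0 ≤ (v.1 - x.1) * dvec.1 + (v.2 - x.2) * dvec.2))
    (hchart : ∀ u ∈ V, ∀ k : Fin 4, u + dir k ∉ V → ∃ (K : Fin 4) (c₁ c₂ : ℤ),
      (∀ v : ℤ × ℤ, |v.1 - u.1| ≤ 3 → |v.2 - u.2| ≤ 3 →
        (v ∈ V ↔ c₂ ≤ v.1 * (dir (K + 1)).1 + v.2 * (dir (K + 1)).2)) ∨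
      (∀ v : ℤ × ℤ, |v.1 - u.1| ≤ 3 → |v.2 - u.2| ≤ 3 →
        (v ∈ V ↔ c₁ ≤ v.1 * (dir K).1 + v.2 * (dir K).2 ∧
          c₂ ≤ v.1 * (dir (K + 1)).1 + v.2 * (dir (K + 1)).2)) ∨
      (∀ v : ℤ × ℤ, |v.1 - u.1| ≤ 3 → |v.2 - u.2| ≤ 3 →
        (v ∈ V ↔ c₂ ≤ v.1 * (dir (K + 1)).1 + v.2 * (dir (K + 1)).2 ∨
          v.1 * (dir K).1 + v.2 * (dir K).2 ≤ c₁)))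
    {ta : ℕ} (hta : ta < (cycle V d₀).length) (hact : (st (ta + 1)).level ≠ (st ta).level)
    {g : ℤ × ℤ} (hgt : g ∈ SixVertex.faceCorners (gapFace (cycle V d₀)[ta])) (hgV : g ∉ V)
    {k : Fin 4} (htr : (ι.model V).IsTracked (toSite g, k)) (hcl : cTgt (toSite g, k) ∉ (ι.model V).cfgOf ∅) :
    ∃ m : ℤ, ((toSite g, k), m) ∈ ι.strandEnds V := by
  have hP := length_cycle_pos ι V hadm h
  obtain ⟨c, K, hch3, hds3⟩ := tc_active_rail3 ι V hadm h hst hflat hta hact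
  obtain ⟨c', K', hch, hchp, hds, hpred1, hpred0⟩ := se_active_rail ι V hadm h hst hflat hta hact
  obtain ⟨rfl, rfl⟩ := Prod.mk.inj (hds3.symm.trans hds)
  obtain ⟨hcV, -, -, -, hsucc, -⟩ := se_rail_local hch
  rw [hds, se_faceCorners_gapFace] at hgt
  simp only [Finset.mem_insert, Finset.mem_singleton] at hgt
  rcases hgt with rfl | rfl | rfl | rfl
  · exact absurd hcV hgV
  · exfalso
    apply hgV
    have e : c + dir (K + 1) = c + (1 : ℤ) • dir (K + 1) + (0 : ℤ) • dir K := by module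
    rw [e]; exact (hch 1 0 (by norm_num) (by norm_num) (by norm_num) (by norm_num)).2 le_rfl
  · exact tc_railGhost_end ι V hadm h hst hta hch hchp hds hpred1 hpred0 hflat hchart htr hcl
  · -- the ghost of the next rail dart `(c + dir (K+1), K)`
    have hg' : c + dir K + dir (K + 1) = c + dir (K + 1) + dir K := by abel
    rw [hg'] at htr hcl ⊢
    have hch₁ : ∀ s t : ℤ, -2 ≤ s → s ≤ 2 → -2 ≤ t → t ≤ 2 →
        (c + dir (K + 1) + s • dir (K + 1) + t • dir K ∈ V ↔ t ≤ 0) := by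
      intro s t hs1 hs2 ht1 ht2
      have e : c + dir (K + 1) + s • dir (K + 1) + t • dir K = c + (1 + s) • dir (K + 1) + t • dir K := by
        module
      rw [e]; exact hch3 _ _ (by omega) (by omega) ht1 ht2
    have hchp₁ : ∀ s t : ℤ, -2 ≤ s → s ≤ 2 → -2 ≤ t → t ≤ 2 →
        (c + dir (K + 1) - dir (K + 1) + s • dir (K + 1) + t • dir K ∈ V ↔ t ≤ 0) := by
      intro s t hs1 hs2 ht1 ht2
      rw [add_sub_cancel_right]; exact hch s t hs1 hs2 ht1 ht2
    have hnext := getElem_succ_mod ι V hadm h hta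
    rw [hds, hsucc] at hnext
    by_cases hlt : ta + 1 < (cycle V d₀).length
    · have heq : (ta + 1) % (cycle V d₀).length = ta + 1 := Nat.mod_eq_of_lt hlt
      simp only [heq] at hnext
      exact tc_railGhost_end ι V hadm h hst hlt hch₁ hchp₁ hnext
        (fun _ => by simp only [Nat.add_sub_cancel, add_sub_cancel_right]; exact hds)
        (fun h0 => absurd h0 (by omega)) hflat hchart htr hcl
    · have heq : (ta + 1) % (cycle V d₀).length = 0 := by
        rw [show ta + 1 = (cycle V d₀).length by omega, Nat.mod_self]
      simp only [heq] at hnext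
      have hlast : (cycle V d₀).length - 1 = ta := by omega
      exact tc_railGhost_end ι V hadm h hst hP hch₁ hchp₁ hnext (fun h1 => absurd h1 (by omega))
        (fun _ => by simp only [hlast, add_sub_cancel_right]; exact hds) hflat hchart htr hcl

include hadm h hst in
/-- **A tracked corner at a ghost with closed target is a registered end.** For a ghost `g` and a
tracked corner `(g, k)` whose target edge is closed in the completed configuration of `∅`
(admissible insertion, flat insertion points, local charts): the face of the corner is the gap face
of a dart `ds[s]` of the cycle touching `g`; if `ds[s]` is silent and wired the target would be a
pocket edge or a spoke (open); otherwise an active dart touches `g` and `tc_active_touch`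
concludes. [folklore] -/
theorem tc_ghost_closed_end
    (hflat : ∀ x ∈ insert ι.sink ι.source, ∃ dvec : ℤ × ℤ,
      (dvec = (1, 0) ∨ dvec = (-1, 0) ∨ dvec = (0, 1) ∨ dvec = (0, -1)) ∧
      ∀ v : ℤ × ℤ, (v.1 - x.1) ^ 2 + (v.2 - x.2) ^ 2 ≤ ((ι.sinkLegs : ℤ) + 3) ^ 2 →
        (v ∈ V ↔ 0 ≤ (v.1 - x.1) * dvec.1 + (v.2 - x.2) * dvec.2))
    (hchart : ∀ u ∈ V, ∀ k : Fin 4, u + dir k ∉ V → ∃ (K : Fin 4) (c₁ c₂ : ℤ),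
      (∀ v : ℤ × ℤ, |v.1 - u.1| ≤ 3 → |v.2 - u.2| ≤ 3 →
        (v ∈ V ↔ c₂ ≤ v.1 * (dir (K + 1)).1 + v.2 * (dir (K + 1)).2)) ∨
      (∀ v : ℤ × ℤ, |v.1 - u.1| ≤ 3 → |v.2 - u.2| ≤ 3 →
        (v ∈ V ↔ c₁ ≤ v.1 * (dir K).1 + v.2 * (dir K).2 ∧
          c₂ ≤ v.1 * (dir (K + 1)).1 + v.2 * (dir (K + 1)).2)) ∨
      (∀ v : ℤ × ℤ, |v.1 - u.1| ≤ 3 → |v.2 - u.2| ≤ 3 →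
        (v ∈ V ↔ c₂ ≤ v.1 * (dir (K + 1)).1 + v.2 * (dir (K + 1)).2 ∨
          v.1 * (dir K).1 + v.2 * (dir K).2 ≤ c₁)))
    (hnp : ∀ x y : ℤ, ((x, y) ∈ V → (x + 1, y + 1) ∈ V → (x + 1, y) ∈ V ∨ (x, y + 1) ∈ V) ∧
      ((x + 1, y) ∈ V → (x, y + 1) ∈ V → (x, y) ∈ V ∨ (x + 1, y + 1) ∈ V))
    {g : ℤ × ℤ} (hgV : g ∉ V) (hg : g ∈ (ι.model V).ghosts) {k : Fin 4}
    (htr : (ι.model V).IsTracked (toSite g, k)) (hcl : cTgt (toSite g, k) ∉ (ι.model V).cfgOf ∅) :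
    ∃ m : ℤ, ((toSite g, k), m) ∈ ι.strandEnds V := by
  have hP := length_cycle_pos ι V hadm h
  -- the face of the corner is the gap face of an exterior dart touching `g`
  have hfc : gapFace (g, k) ∈ (ι.model V).faceCells := (se_gapFace_eq_cFace g k).1 ▸ htr.2
  have hu : ∃ u ∈ V, u ∈ SixVertex.faceCorners (gapFace (g, k)) := by
    rw [faceCells, SixVertex.faces, Finset.mem_biUnion] at hfc
    obtain ⟨u, huV, hu⟩ := hfc
    exact ⟨u, huV, se_mem_faceCorners_of_mem_vertexFaces hu⟩
  obtain ⟨df, hdf1, hdf2, hgap⟩ := tc_exists_dart_of_face hgV k hu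
  have hgdf : g ∈ SixVertex.faceCorners (gapFace df) := hgap ▸ se_self_mem_faceCorners_gapFace (g, k)
  -- an entry of the walk mentioning `g`; its dart touches `g`
  obtain ⟨tm, htm, hm⟩ := tc_ghost_mention ι V hadm h hst hflat hchart hg
  have hgm := touch_of_mention V hm
  obtain ⟨hu₁, hg₁⟩ := cycle_getElem_exterior ι V hadm h htm
  have hch := chart_of_bdry_chart hchart hu₁ hg₁ hgm
  -- so `df` is a dart of the cycle
  obtain ⟨s, hs, hdfs⟩ : ∃ (s : ℕ) (_ : s < (cycle V d₀).length), (cycle V d₀)[s] = df := by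
    rcases touch_chain hch hu₁ hg₁ hdf1 hdf2 hgm hgdf with he | he | he | ⟨e₃, hu₃, hg₃, -, he⟩
    · exact ⟨tm, htm, he⟩
    · exact ⟨(tm + 1) % (cycle V d₀).length, Nat.mod_lt _ hP, by rw [getElem_succ_mod ι V hadm h htm, he]⟩
    · exact ⟨_, Nat.mod_lt _ hP, getElem_pred_mod ι V hadm h htm hdf1 hdf2 he.symm⟩
    · rcases he with ⟨h31, h32⟩ | ⟨h31, h32⟩
      · have hlt : (tm + 1) % (cycle V d₀).length < (cycle V d₀).length := Nat.mod_lt _ hP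
        refine ⟨((tm + 1) % (cycle V d₀).length + 1) % (cycle V d₀).length, Nat.mod_lt _ hP, ?_⟩
        rw [getElem_succ_mod ι V hadm h hlt, getElem_succ_mod ι V hadm h htm, ← h31, h32]
      · have h3 := getElem_pred_mod ι V hadm h htm hu₃ hg₃ h32.symm
        have hlt : (tm + (cycle V d₀).length - 1) % (cycle V d₀).length < (cycle V d₀).length :=
          Nat.mod_lt _ hP
        exact ⟨_, Nat.mod_lt _ hP, getElem_pred_mod ι V hadm h hlt hdf1 hdf2 (by rw [h3]; exact h31.symm)⟩
  have hgs : g ∈ SixVertex.faceCorners (gapFace (cycle V d₀)[s]) := by rw [hdfs]; exact hgdf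
  by_cases hact : (st (s + 1)).level ≠ (st s).level
  · exact tc_active_touch ι V hadm h hst hflat hchart hs hact hgs hgV htr hcl
  · -- `ds[s]` is silent
    have hsil : (st (s + 1)).wired = (st s).wired := by
      rcases st_step_cases ι V hst hs with ⟨-, hw⟩ | ⟨hsgn, hc⟩
      · exact hw
      · exfalso
        rcases hc with ⟨hl, -⟩ | ⟨hl, -, -⟩ <;> rcases hsgn with h1 | h1 <;> rw [h1] at hl <;> omega
    cases hw1 : (st (s + 1)).wired
    · -- free on both sides: an active dart touches `g`
      have hw0 : (st s).wired = false := hsil ▸ hw1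
      obtain ⟨ta, hta, hacta, hgta⟩ := tc_free_touch ι V hadm h hst hchart hs hgs hw0 hw1 htm hm
      exact tc_active_touch ι V hadm h hst hflat hchart hta hacta hgta hgV htr hcl
    · -- wired after `ds[s]`: the face is a pocket and the target is open
      exfalso
      apply hcl
      obtain ⟨hus, hgs'⟩ := cycle_getElem_exterior ι V hadm h hs
      have hpC : gapFace (cycle V d₀)[s] ∈ (ι.collar V).pocket :=
        (mem_collar_pocket_iff ι V h hst).2 ⟨s, hs, hw1, rfl⟩
      have hp : gapFace (g, k) ∈ (ι.model V).pockets := by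
        rw [← hgap, ← hdfs]
        exact Finset.mem_inter.2 ⟨hpC, tc_gapFace_mem_bdryFaces hus hgs'⟩
      obtain ⟨e, hc, hend⟩ := se_corner_edge g k
      have he : e ∈ faceEdges (gapFace (g, k)) := tc_target_mem_faceEdges g k hend
      have hgVC : g ∈ (ι.model V).vertexCells := by simpa using htr.1
      rw [se_cTgt_mem_cfgOf_iff _ _ hc]
      right
      by_cases haV : g + dir (k + 1) ∈ V
      · -- the far endpoint is an arc vertex: the target is a spoke
        have haC : g + dir (k + 1) ∈ SixVertex.faceCorners (gapFace (cycle V d₀)[s]) := by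
          rw [hdfs, hgap]
          exact (mem_faceCorners_gapFace g _ k).2 (Or.inr (Or.inr (Or.inl rfl)))
        have harc := pocketCorner_mem_arc ι V hadm h hst hnp hs hw1 haC haV hgs hgV (tc_adj_add_dir g (k + 1))
        have harcV : g + dir (k + 1) ∈ (ι.model V).arcVerts := Finset.mem_inter.2 ⟨harc, haV⟩
        have hg3 : g + dir (k + 1) + dir (k + 3) = g := by rw [tp_dir_add_three]; abel
        refine (tc_spoke_open (ι.model V) (K := k + 3) harcV (by rw [hg3]; exact hgV) (e := e) ?_).2
        rw [hg3]; exact hend.symm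
      · refine tc_pocketEdge_open _ hp he ?_ ?_ ?_
        · rcases hend with ⟨h1, -⟩ | ⟨h1, -⟩ <;> rw [h1]
          exacts [hgV, haV]
        · rcases hend with ⟨-, h2⟩ | ⟨-, h2⟩ <;> rw [h2]
          exacts [haV, hgV]
        · rcases hend with ⟨h1, -⟩ | ⟨-, h2⟩
          · exact Or.inl (h1 ▸ hgVC)
          · exact Or.inr (h2 ▸ hgVC)

end Admissible

/-! ### The theorem -/

/-- **Every tracked cut corner is a registered strand end** (hypothesis (E1) of the rainbow
forcing, Parts 18/19). For an ADMISSIBLE leg insertion `ι` on `V` whose insertion points are FLAT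
at radius `sinkLegs + 3` and whose boundary vertices carry local CHARTS at radius `3`: every
tracked corner `c` of the jump collar `ι.model V` that is a cut (`IsCut`) satisfies
`(c, m) ∈ ι.strandEnds V` for some tag `m` — it is the finish of a jump edge or the end of a
junction opening the arc. [folklore] -/
theorem tc_trackedCuts_are_ends (ι : LegInsertionData) (V : Finset (ℤ × ℤ)) (hadm : ι.IsAdmissible V)
    (hflat : ∀ x ∈ insert ι.sink ι.source, ∃ dvec : ℤ × ℤ,
      (dvec = (1, 0) ∨ dvec = (-1, 0) ∨ dvec = (0, 1) ∨ dvec = (0, -1)) ∧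
      ∀ v : ℤ × ℤ, (v.1 - x.1) ^ 2 + (v.2 - x.2) ^ 2 ≤ ((ι.sinkLegs : ℤ) + 3) ^ 2 →
        (v ∈ V ↔ 0 ≤ (v.1 - x.1) * dvec.1 + (v.2 - x.2) * dvec.2))
    (hchart : ∀ u ∈ V, ∀ k : Fin 4, u + dir k ∉ V → ∃ (K : Fin 4) (c₁ c₂ : ℤ),
      (∀ v : ℤ × ℤ, |v.1 - u.1| ≤ 3 → |v.2 - u.2| ≤ 3 →
        (v ∈ V ↔ c₂ ≤ v.1 * (dir (K + 1)).1 + v.2 * (dir (K + 1)).2)) ∨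
      (∀ v : ℤ × ℤ, |v.1 - u.1| ≤ 3 → |v.2 - u.2| ≤ 3 →
        (v ∈ V ↔ c₁ ≤ v.1 * (dir K).1 + v.2 * (dir K).2 ∧
          c₂ ≤ v.1 * (dir (K + 1)).1 + v.2 * (dir (K + 1)).2)) ∨
      (∀ v : ℤ × ℤ, |v.1 - u.1| ≤ 3 → |v.2 - u.2| ≤ 3 →
        (v ∈ V ↔ c₂ ≤ v.1 * (dir (K + 1)).1 + v.2 * (dir (K + 1)).2 ∨
          v.1 * (dir K).1 + v.2 * (dir K).2 ≤ c₁)))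
    (c : Site 2 × Fin 4) (htr : (ι.model V).IsTracked c) (hcut : (ι.model V).IsCut c) :
    ∃ m : ℤ, (c, m) ∈ ι.strandEnds V := by
  obtain ⟨d₀, h, -⟩ := s3_of_admissible ι V hadm
  have hst : ∀ t, (fun t => List.foldl (fun s d => s.step (ι.startAt V d)) ι.init
      ((cycle V d₀).take t)) t = List.foldl (fun s d => s.step (ι.startAt V d)) ι.init
      ((cycle V d₀).take t) := fun _ => rfl
  have hnp := tc_noPinch_of_chart hchart
  obtain ⟨x, k⟩ := c
  have hx : x = toSite (ofSite x) := by funext i; fin_cases i <;> simp [toSite, ofSite]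
  rw [hx] at htr hcut ⊢
  set v := ofSite x with hv
  by_cases hm : cTgt (toSite v, k) ∈ (ι.model V).cfgOf ∅
  · exact absurd (tc_turnConsistent_of_open ι V hadm hflat hchart htr hm) hcut.2
  · by_cases hvV : v ∈ V
    · have hvK : v + dir (k + 1) ∉ V := fun h' => hcut.1 ((se_targetsLive_iff _ v k).2 ⟨hvV, h'⟩)
      have hk : k = k + 1 + 3 := ((tp_fin4 k).2.2.2.2.1).symm
      rw [hk] at hm hcut ⊢
      exact tc_vertex_closed_end ι V hadm h hst hnp hvV hvK hm hcut
    · have hg : v ∈ (ι.model V).ghosts := by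
        have h1 := htr.1
        simp only [ofSite_toSite] at h1
        exact (Finset.mem_union.1 h1).resolve_left hvV
      exact tc_ghost_closed_end ι V hadm h hst hflat hchart hnp hvV hg htr hm

/-- **Rainbow forcing with every strand-end input discharged** (`rainbow_of_strandEnds_of_admissible`
of Part 19 with (E1) from `tc_trackedCuts_are_ends`, (E2)/(E3) from Part 27, the level pairs and
tags from Parts 22/23, `NoPinch` from `CHART`): for an admissible insertion with FLAT insertion
points on a locally CHARTED `V`, if every live turn over the piece is consistent for the valid
configuration `hh` in `cfgOf ω`, `ω ⊆ E`, then `ω` is a RAINBOW configuration. [folklore] -/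
theorem tc_rainbow_of_consistent (ι : LegInsertionData) (V : Finset (ℤ × ℤ)) (hadm : ι.IsAdmissible V)
    (hflat : ∀ x ∈ insert ι.sink ι.source, ∃ dvec : ℤ × ℤ,
      (dvec = (1, 0) ∨ dvec = (-1, 0) ∨ dvec = (0, 1) ∨ dvec = (0, -1)) ∧
      ∀ v : ℤ × ℤ, (v.1 - x.1) ^ 2 + (v.2 - x.2) ^ 2 ≤ ((ι.sinkLegs : ℤ) + 3) ^ 2 →
        (v ∈ V ↔ 0 ≤ (v.1 - x.1) * dvec.1 + (v.2 - x.2) * dvec.2))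
    (hchart : ∀ u ∈ V, ∀ k : Fin 4, u + dir k ∉ V → ∃ (K : Fin 4) (c₁ c₂ : ℤ),
      (∀ v : ℤ × ℤ, |v.1 - u.1| ≤ 3 → |v.2 - u.2| ≤ 3 →
        (v ∈ V ↔ c₂ ≤ v.1 * (dir (K + 1)).1 + v.2 * (dir (K + 1)).2)) ∨
      (∀ v : ℤ × ℤ, |v.1 - u.1| ≤ 3 → |v.2 - u.2| ≤ 3 →
        (v ∈ V ↔ c₁ ≤ v.1 * (dir K).1 + v.2 * (dir K).2 ∧
          c₂ ≤ v.1 * (dir (K + 1)).1 + v.2 * (dir (K + 1)).2)) ∨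
      (∀ v : ℤ × ℤ, |v.1 - u.1| ≤ 3 → |v.2 - u.2| ≤ 3 →
        (v ∈ V ↔ c₂ ≤ v.1 * (dir (K + 1)).1 + v.2 * (dir (K + 1)).2 ∨
          v.1 * (dir K).1 + v.2 * (dir K).2 ≤ c₁)))
    {ω : Finset ((ℤ × ℤ) × Bool)} {hh : ↥(ι.model V).freeCells → ℤ} (hω : ω ⊆ (ι.model V).E)
    (H1 : ∀ c ∈ Literature.Probability.Percolation.cornerSet (ι.model V).piece,
      (ι.model V).TargetsLive c → (ι.model V).TurnConsistent hh ((ι.model V).cfgOf ω) c)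
    (hvalid : (ι.model V).IsValid hh) : ι.Rainbow V ω :=
  rainbow_of_strandEnds_of_admissible ι V hadm (tc_noPinch_of_chart hchart) hω H1
    (s14_strandEnds_pairs ι V hadm hflat) (s14_strandEnds_tags ι V hadm hflat)
    (tc_trackedCuts_are_ends ι V hadm hflat hchart) (s14_strandEnds_start ι V hadm hflat)
    (s14_strandEnds_types ι V hadm hflat) hvalid

/-! ### Registered one-line form -/

/-- **Sub-goal `s14_trackedCuts_are_ends`** of `stub_dictionaryPositivity` (registered on
stmt-CriticalPhenomena-14132; D2 layer 3b, hypothesis (E1) of the rainbow forcing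
`s14_rainbow_of_valid`): for an ADMISSIBLE leg insertion `ι` on `V` whose insertion points are
FLAT at radius `sinkLegs + 3` (hypothesis `FLAT`) and whose boundary vertices carry local
half-plane / convex-corner / reflex-corner CHARTS at radius `3` (hypothesis `CHART`), EVERY TRACKED
CUT CORNER of the jump collar `ι.model V` IS A REGISTERED STRAND END:
`∀ c, IsTracked c → IsCut c → ∃ m, (c, m) ∈ ι.strandEnds V`. [folklore] -/
theorem s14_trackedCuts_are_ends : ∀ (ι : Literature.Probability.LatticeModels.CollarLegModel.LegInsertionData) (V : Finset (ℤ × ℤ)), ι.IsAdmissible V → (∀ x ∈ insert ι.sink ι.source, ∃ dvec : ℤ × ℤ, (dvec = (1, 0) ∨ dvec = (-1, 0) ∨ dvec = (0, 1) ∨ dvec = (0, -1)) ∧ ∀ v : ℤ × ℤ, (v.1 - x.1) ^ 2 + (v.2 - x.2) ^ 2 ≤ ((ι.sinkLegs : ℤ) + 3) ^ 2 → (v ∈ V ↔ 0 ≤ (v.1 - x.1) * dvec.1 + (v.2 - x.2) * dvec.2)) → (∀ u ∈ V, ∀ k : Fin 4, u + Literature.Probability.LatticeModels.CollarLegModel.dir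 k ∉ V → ∃ (K : Fin 4) (c₁ c₂ : ℤ), (∀ v : ℤ × ℤ, |v.1 - u.1| ≤ 3 → |v.2 - u.2| ≤ 3 → (v ∈ V ↔ c₂ ≤ v.1 * (Literature.Probability.LatticeModels.CollarLegModel.dir (K + 1)).1 + v.2 * (Literature.Probability.LatticeModels.CollarLegModel.dir (K + 1)).2)) ∨ (∀ v : ℤ × ℤ, |v.1 - u.1| ≤ 3 → |v.2 - u.2| ≤ 3 → (v ∈ V ↔ c₁ ≤ v.1 * (Literature.Probability.LatticeModels.CollarLegModel.dir K).1 + v.2 * (Literature.Probability.LatticeModels.CollarLegModel.dir K).2 ∧ c₂ ≤ v.1 * (Literature.Probability.LatticeModels.CollarLegModel.dir (K + 1)).1 + v.2 * (Literature.Probability.LatticeModels.CollarLegModel.dir (K + 1)).2)) ∨ (∀ v : ℤ × ℤ, |v.1 - u.1| ≤ 3 → |v.2 - u.2| ≤ 3 → (v ∈ V ↔ c₂ ≤ v.1 * (Literature.Probability.LatticeModels.CollarLegModel.dir (K + 1)).1 + v.2 * (Literature.Probability.LatticeModels.CollarLegModel.dir (K + 1)).2 ∨ v.1 * (Literature.Probability.LatticeModels.CollarLegModel.dir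 K).1 + v.2 * (Literature.Probability.LatticeModels.CollarLegModel.dir K).2 ≤ c₁))) → ∀ c : Literature.Probability.LatticeModels.Site 2 × Fin 4, (ι.model V).IsTracked c → (ι.model V).IsCut c → ∃ m : ℤ, (c, m) ∈ ι.strandEnds V :=
  fun ι V hadm hflat hchart c htr hcut => tc_trackedCuts_are_ends ι V hadm hflat hchart c htr hcut

end Summit.CriticalPhenomena.CardyFormulaZ2.Cruxes.BoundaryDefectGaussianR.RainbowMonomialsInExcursionKernels
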